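import Mathlib
import Summits.ResolutionOfSingularities.ResolutionOfSingularities.Theses.WildQuotients
import Summits.ResolutionOfSingularities.ResolutionOfSingularities.Theorems.WildQuotientsJordanBlockFourfoldOrder
import Summits.ResolutionOfSingularities.ResolutionOfSingularities.Theorems.WildQuotientsWildQuotientResolutionAffineQuotientEtale
import Summits.ResolutionOfSingularities.ResolutionOfSingularities.Theorems.WildQuotientsWildQuotientResolutionFixedPointsGraded
import Literature.RingTheory.KrullDimension.AffineDimension
import Literature.AlgebraicGeometry.Resolution.ProjectiveSpaceRegular
import HarnessLib

/-!
# `JordanBlockFourfold` is a special case of `CyclicQuotientFourfolds` (chain w45c, J2)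

(crux stmt-ResolutionOfSingularities-15640 `WildQuotients.WildQuotientResolution`, line `Sketch`;
route items `CyclicQuotientFourfolds` stmt-17941 (the first open case) and `JordanBlockFourfold`
stmt-17942 (the computed instance); [OURS · L1 W4.5c] — NOT a statement of any manuscript.)

The affine quotient `𝔸⁴ → 𝔸⁴/⟨σ⟩ = Spec k[x₀,…,x₃]^σ` by the unipotent `4 × 4` Jordan block `σ`
(`p ≥ 5`, so `⟨σ⟩ ≅ ℤ/p`, `JordanBlock.jordanBlock_order`) IS a datum of `CyclicQuotientFourfolds`:
`X′ = Spec k[x]` is regular integral, `X₁ = Spec k[x]^σ` is integral of finite type (E. Noether),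
`q : X′ → X₁` is finite and surjective (`k[x]` is integral over `k[x]^σ`), invariant under the action
`g ↦ Spec (g⁻¹)` of `⟨σ⟩` on `X′`, its fibres are the orbits (Mathlib
`Algebra.IsInvariant.exists_smul_of_under_eq`), it is étale over the dense open `D(x₀)` — `x₀` is
invariant and lies in the augmentation ideal of every `σʲ ≠ 1` since `σʲ x₁ - x₁ = j x₀`
(`AffineQuotient.exists_dense_etale_morphismRestrict`) — and `dim X₁ = dim X′ = 4` (integral
extensions preserve dimension). Hence `CyclicQuotientFourfolds → JordanBlockFourfold`
(`jordanBlockFourfold_of_cyclicQuotientFourfolds`), and a disproof of the computed instance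
disproves the first open case, the crux and the summit
(`not_cyclicQuotientFourfolds_of_not_jordanBlockFourfold`, with
`FirstOpenCase.not_wildQuotientResolution_of_not_cyclicQuotientFourfolds`).
-/

-- single-problem summit: the doubled namespace component `ResolutionOfSingularities` is forced
set_option linter.dupNamespace false

noncomputable section

open CategoryTheory AlgebraicGeometry TopologicalSpace MvPolynomial
open scoped Pointwise
open Literature.AlgebraicGeometry.Resolution
open Summit.ResolutionOfSingularities.ResolutionOfSingularities.Theses.WildQuotients

namespace Summit.ResolutionOfSingularities.ResolutionOfSingularities.Theorems.WildQuotientResolution.JordanBlock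

/-- **`x₀` lies in the augmentation ideal of every non-trivial element of `⟨σ⟩`.** For the Jordan
block `σ` on `k[x₀,…,x₃]` over a field of characteristic `p` with `σ ^ p = 1` and `g = σⁿ ≠ 1` in
`⟨σ⟩`: `p ∤ n`, and `g • x₁ - x₁ = n x₀` with `n` invertible in `k`, so `x₀ ∈ (g • b - b : b)`.
[folklore] -/
theorem X_zero_mem_augIdeal (p : ℕ) (hp : p.Prime) (k : Type) [Field k] [CharP k p]
    (σ : MvPolynomial (Fin 4) k ≃ₐ[k] MvPolynomial (Fin 4) k)
    (h0 : σ (MvPolynomial.X 0) = MvPolynomial.X 0)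
    (h1 : σ (MvPolynomial.X 1) = MvPolynomial.X 1 + MvPolynomial.X 0)
    (h2 : σ (MvPolynomial.X 2) = MvPolynomial.X 2 + MvPolynomial.X 1)
    (h3 : σ (MvPolynomial.X 3) = MvPolynomial.X 3 + MvPolynomial.X 2)
    (hσp : σ ^ p = 1) (g : Subgroup.zpowers σ) (hg : g ≠ 1) :
    (MvPolynomial.X 0 : MvPolynomial (Fin 4) k) ∈
      Ideal.span (Set.range fun b : MvPolynomial (Fin 4) k => g • b - b) := by
  classical
  -- `g = σ ^ n` with `p ∤ n`
  have hfin : IsOfFinOrder σ := isOfFinOrder_iff_pow_eq_one.mpr ⟨p, hp.pos, hσp⟩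
  obtain ⟨n, hn⟩ : (g : MvPolynomial (Fin 4) k ≃ₐ[k] MvPolynomial (Fin 4) k) ∈ Submonoid.powers σ :=
    hfin.mem_powers_iff_mem_zpowers.mpr g.2
  have hn' : σ ^ n = (g : MvPolynomial (Fin 4) k ≃ₐ[k] MvPolynomial (Fin 4) k) := hn
  have hndvd : ¬ p ∣ n := by
    rintro ⟨m, rfl⟩
    apply hg
    apply Subtype.ext
    change (g : MvPolynomial (Fin 4) k ≃ₐ[k] MvPolynomial (Fin 4) k) = 1
    rw [← hn', pow_mul, hσp, one_pow]
  have hnk : (n : k) ≠ 0 := fun h => hndvd ((CharP.cast_eq_zero_iff k p n).mp h)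
  -- `g • x₁ - x₁ = n x₀`
  obtain ⟨-, e1, -, -⟩ := jordanBlock_pow_apply_X k σ h0 h1 h2 h3 n
  have hsmul : g • (X 1 : MvPolynomial (Fin 4) k) - X 1 = (n : MvPolynomial (Fin 4) k) * X 0 := by
    change (g : MvPolynomial (Fin 4) k ≃ₐ[k] MvPolynomial (Fin 4) k) (X 1) - X 1 = _
    rw [← hn', e1]
    ring
  -- `x₀ = n⁻¹ (g • x₁ - x₁)`
  have hx0 : (X 0 : MvPolynomial (Fin 4) k) =
      C ((n : k)⁻¹) * (g • (X 1 : MvPolynomial (Fin 4) k) - X 1) := by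
    rw [hsmul, ← mul_assoc, ← map_natCast (C : k →+* MvPolynomial (Fin 4) k) n, ← map_mul,
      inv_mul_cancel₀ hnk, map_one, one_mul]
  rw [hx0]
  exact Ideal.mul_mem_left _ _ (Ideal.subset_span ⟨X 1, rfl⟩)

/-- **`JordanBlockFourfold` is a special case of `CyclicQuotientFourfolds`.** The affine quotient
`𝔸⁴ → 𝔸⁴/⟨σ⟩ = Spec k[x₀,…,x₃]^σ` by the Jordan block of size `4` in characteristic `p ≥ 5` is a
datum of `CyclicQuotientFourfolds` (regular integral source, integral finite-type target, `q`
finite surjective invariant with fibres the orbits, étale over the dense open `D(x₀)`, `|⟨σ⟩| = p`,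
`dim = 4`), so the first open case yields a resolution of `𝔸⁴/V₄`. [cite: SGA1, Exp. V, §1–2]
-/
theorem jordanBlockFourfold_of_cyclicQuotientFourfolds (hC : CyclicQuotientFourfolds) :
    JordanBlockFourfold := by
  intro p hp hp5 k _ _ _ σ h0 h1 h2 h3
  classical
  haveI : Fact p.Prime := ⟨hp⟩
  obtain ⟨hσp, -, hcard⟩ := jordanBlock_order p hp hp5 k σ h0 h1 h2 h3
  -- the rings: `S = k[x₀,…,x₃]`, `G = ⟨σ⟩`, `A = S^G`
  let S : Type := MvPolynomial (Fin 4) k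
  let G : Type := ↥(Subgroup.zpowers σ)
  haveI : Finite G := Nat.finite_of_card_ne_zero (hcard ▸ hp.ne_zero)
  let A : Subalgebra k S := FixedPoints.subalgebra k S G
  -- the schemes and morphisms
  let f : Spec (.of A) ⟶ Spec (.of k) := Spec.map (CommRingCat.ofHom (algebraMap k A))
  let q : Spec (.of S) ⟶ Spec (.of A) := Spec.map (CommRingCat.ofHom (algebraMap A S))
  -- the action `g ↦ Spec (g⁻¹)` of `G` on `X′ = Spec S`
  let tRE : G →* (S ≃+* S) := MulSemiringAction.toRingEquiv G S
  have htRE : ∀ (g : G) (s : S), tRE g s = g • s := fun g s => rfl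
  let ρ : G →* Aut (Spec (CommRingCat.of S)) := MonoidHom.mk'
    (fun g => Scheme.Spec.mapIso (tRE g⁻¹).toCommRingCatIso.op)
    (fun g h => by
      apply Iso.ext
      change Spec.map (CommRingCat.ofHom ((tRE (g * h)⁻¹ : S ≃+* S) : S →+* S)) =
        Spec.map (CommRingCat.ofHom ((tRE h⁻¹ : S ≃+* S) : S →+* S)) ≫
          Spec.map (CommRingCat.ofHom ((tRE g⁻¹ : S ≃+* S) : S →+* S))
      rw [← Spec.map_comp, ← CommRingCat.ofHom_comp]
      -- `(g h)⁻¹ • s = h⁻¹ • (g⁻¹ • s)` holds definitionally for the action of `⟨σ⟩`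
      congr 2)
  have hρ_hom : ∀ g : G, (ρ g).hom =
      Spec.map (CommRingCat.ofHom ((tRE g⁻¹ : S ≃+* S) : S →+* S)) := fun _ => rfl
  -- points: `(ρ g) x` has ideal `g • 𝔭ₓ`
  have hρ_base : ∀ (g : G) (x : Spec (CommRingCat.of S)),
      ((ρ g).hom.base x).asIdeal = g • x.asIdeal := by
    intro g x
    ext s
    -- `s ∈ (g⁻¹)⁻¹(𝔭ₓ) ↔ g⁻¹ • s ∈ 𝔭ₓ ↔ s ∈ g • 𝔭ₓ`
    exact (Ideal.mem_pointwise_smul_iff_inv_smul_mem (a := g) (S := x.asIdeal) (x := s)).symm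
  -- (1) `|G| = p`: `hcard`
  -- (2) `f` locally of finite type (E. Noether)
  have hft : LocallyOfFiniteType f := by
    rw [HasRingHomProperty.Spec_iff (P := @LocallyOfFiniteType), CommRingCat.hom_ofHom,
      RingHom.finiteType_algebraMap]
    infer_instance
  -- (3) `q` finite and surjective
  have hfin : IsFinite q := by
    rw [IsFinite.SpecMap_iff, CommRingCat.hom_ofHom, RingHom.finite_algebraMap]
    infer_instance
  have hsurj : Function.Surjective q.base := by
    haveI : FaithfulSMul A S := (faithfulSMul_iff_algebraMap_injective _ _).mpr Subtype.val_injective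
    exact Algebra.IsIntegral.comap_surjective _ _
  -- (4) generically étale: over `D(x₀)`
  have hX0 : (X 0 : S) ∈ A := (TameTransfer.mem_fixedPoints_zpowers_iff_apply_eq σ (X 0)).mpr h0
  have ht0 : (⟨X 0, hX0⟩ : A) ≠ 0 := fun h => MvPolynomial.X_ne_zero (0 : Fin 4)
    (congrArg Subtype.val h : ((⟨X 0, hX0⟩ : A) : S) = ((0 : A) : S))
  have hU : ∃ U : (Spec (.of A)).Opens, Dense (U : Set (Spec (.of A))) ∧ Etale (q ∣_ U) :=
    AffineQuotient.exists_dense_etale_morphismRestrict k (⟨X 0, hX0⟩ : A) ht0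
      fun g hg => X_zero_mem_augIdeal p hp k σ h0 h1 h2 h3 hσp g hg
  -- (5) `q` is `G`-invariant
  have hρ : ∀ g : G, (ρ g).hom ≫ q = q := by
    intro g
    rw [hρ_hom]
    change Spec.map _ ≫ Spec.map (CommRingCat.ofHom (algebraMap A S)) =
      Spec.map (CommRingCat.ofHom (algebraMap A S))
    rw [← Spec.map_comp, ← CommRingCat.ofHom_comp]
    congr 2
    refine RingHom.ext fun a => ?_
    change (tRE g⁻¹ : S ≃+* S) (a : S) = (a : S)
    rw [htRE]
    exact a.2 g⁻¹
  -- (6) the fibres of `q` are the orbits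
  have horb : ∀ x y : Spec (CommRingCat.of S), q.base x = q.base y →
      ∃ g : G, (ρ g).hom.base x = y := by
    intro x y hxy
    have hxy' : x.asIdeal.under A = y.asIdeal.under A := congrArg PrimeSpectrum.asIdeal hxy
    obtain ⟨g, hg⟩ := Algebra.IsInvariant.exists_smul_of_under_eq A S G x.asIdeal y.asIdeal hxy'
    exact ⟨g, PrimeSpectrum.ext ((hρ_base g x).trans hg.symm)⟩
  -- (7) `dim X₁ = 4`
  have hdim : topologicalKrullDim (Spec (CommRingCat.of A)) ≤ 4 := by
    have hS : ringKrullDim S = (4 : ℕ) := by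
      show ringKrullDim (MvPolynomial (Fin 4) k) = (4 : ℕ)
      rw [MvPolynomial.ringKrullDim_of_isNoetherianRing, ringKrullDim_eq_zero_of_field]
      simp
    have hA : ringKrullDim A = ringKrullDim S :=
      Literature.RingTheory.KrullDimension.ringKrullDim_eq_of_isIntegral (R := A) (S := S)
        Subtype.val_injective
    change topologicalKrullDim (PrimeSpectrum A) ≤ 4
    rw [PrimeSpectrum.topologicalKrullDim_eq_ringKrullDim, hA, hS]
    exact le_of_eq (by norm_cast)
  -- assemble
  exact hC p hp k (Spec (.of S)) (Spec (.of A)) f q G ρ hcard inferInstance hft inferInstance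
    inferInstance inferInstance (Literature.AlgebraicGeometry.Resolution.Scheme.isRegular_Spec _)
    hfin hsurj hU hρ horb hdim

/-- **A disproof of the computed instance disproves the first open case** (contrapositive): with
`FirstOpenCase.not_wildQuotientResolution_of_not_cyclicQuotientFourfolds` and
`Negative.not_resolutionOfSingularities_of_not_wildQuotientResolution`, a scheme-theoretic proof
that `𝔸⁴/V₄` has no resolution for some `p ≥ 5` over a perfect field would refute the crux and
the summit. [folklore] -/
theorem not_cyclicQuotientFourfolds_of_not_jordanBlockFourfold (h : ¬ JordanBlockFourfold) :
    ¬ CyclicQuotientFourfolds :=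
  fun hC => h (jordanBlockFourfold_of_cyclicQuotientFourfolds hC)

end Summit.ResolutionOfSingularities.ResolutionOfSingularities.Theorems.WildQuotientResolution.JordanBlock

end
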